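import Summits.CriticalPhenomena.PercolationContinuityZ3.Theorems.PercNearOneGluingNoHeavyLowerTailIncStarStrongInduction
import HarnessLib

/-!
# The increasing star from ORDER-1 (`3B₁ ≥ B₀`, `3B₂ ≥ B₃`) along root–unmarked edges

Support file for the Sahi programme (`--supports stmt-CriticalPhenomena-4575`, prover prim-sahi-p2 gen 7).  No definitions, no named facts,
no sorries; standard axioms.  Nothing here asserts the increasing star; this is a conditional schema.

Along an edge `e` the increasing star `E₃({s↔b},{s↔c},{s↔y})` is a Bernstein cubic in `p = w e` with coefficients
`B₀ = E₃(P_{w[e↦0]})`, `B₁ = polar₁ P₀ P₁`, `B₂ = polar₁ P₁ P₀`, `B₃ = E₃(P_{w[e↦1]})` (`EdgeInduction.sahiE3_oneBond`).  The schemas landed so far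
take as the root–unmarked step `B₁, B₂ ≥ 0` (hRZ, `IncStar.incStar_nonneg_of_rootUnmarkedBernsteinStrongIH`), the open-end KEY `3B₂ − 2B₃ ≥ 0`
(`…IncStarKeyBernstein`), or its chord form (refuted as a hypothesis, `…IncStarKeyChord`).  This file records the ORDER-1 form of the step:

  `3·B₁ ≥ B₀` and `3·B₂ ≥ B₃` along every fractional root–unmarked edge (with the full induction hypothesis available)  ⟹  increasing star,

because `B₀, B₃ ≥ 0` ARE the induction hypothesis at the two minors `w[e↦0]`, `w[e↦1]` (fewer fractional pairs).  ORDER-1 is the pair of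
coefficientwise inequalities "`c₁ ≥ c₀` and `c₂ ≥ c₃` on every comb line" (COMB-M∓ of the comb-polynomial census; exhaustively without
counterexample for all triples of up-sets of `{0,1}^m`, `m ≤ 5`, and sampled to `m = 7`), conjectured for ALL increasing events under product
measures — in contrast with the open-end KEY `3B₂ ≥ 2B₃`, which fails for general increasing events already on `{0,1}^5` and is specific to
connectivity events (memo FROM-prim-sahi-p2-gen7-KEY-GENERALITY.md, PROOF-E3 §18).  At root–TARGET edges `3B₁ ≥ (3/2)B₀` and `3B₂ ≥ (1/2)B₀ ≥ 0`
are proved (`IncStar.rootTarget_polar_nonneg` and its certificate), so only root–unmarked edges carry a hypothesis.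

* `incStar_nonneg_of_rootUnmarkedOrderOne` — the schema;
* `incStar_nonneg_of_orderOne` — the marking-free corollary: ORDER-1 along every fractional non-loop ROOT pair suffices.
-/

noncomputable section

namespace Summit.CriticalPhenomena.PercolationContinuityZ3.Theorems

namespace IncStar

open MeasureTheory Set Literature.Probability.Percolation Literature.Probability.LatticeModels EdgeInduction
open scoped Classical

variable {n : ℕ}

/-- **The increasing star from ORDER-1 along root–unmarked edges.**  Suppose that for every weight `w`, every marking `s b c y`, every
vertex `z ∉ {s,b,c,y}` with `e = s(s,z)` fractional, and granted the increasing star for every weight with fewer fractional non-loop pairs and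
every marking, the Bernstein coefficients of `E₃({s↔b},{s↔c},{s↔y})` along `e` satisfy `B₀ ≤ 3B₁` and `B₃ ≤ 3B₂`
(`B₀ = E₃(P_{w[e↦0]})`, `B₁ = polar₁ P_{w[e↦0]} P_{w[e↦1]}`, `B₂ = polar₁ P_{w[e↦1]} P_{w[e↦0]}`, `B₃ = E₃(P_{w[e↦1]})`).
Then the increasing star holds on every finite weighted graph on `Fin n`. [this work] -/
theorem incStar_nonneg_of_rootUnmarkedOrderOne
    (hO : ∀ (w : Sym2 (Fin n) → unitInterval) (s b c y z : Fin n), z ≠ s → z ≠ b → z ≠ c → z ≠ y → s(s, z) ∈ fracEdges w →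
      (∀ w' : Sym2 (Fin n) → unitInterval,
          ((fracEdges w').filter fun f => ¬ f.IsDiag).card < ((fracEdges w).filter fun f => ¬ f.IsDiag).card →
          ∀ s' b' c' y' : Fin n, 0 ≤ sahiE3 (prodBernoulli w') (openConn s' b') (openConn s' c') (openConn s' y')) →
      sahiE3 (prodBernoulli (Function.update w s(s, z) 0)) (openConn s b) (openConn s c) (openConn s y) ≤
          3 * polar₁ (prodBernoulli (Function.update w s(s, z) 0)) (prodBernoulli (Function.update w s(s, z) 1))
            (openConn s b) (openConn s c) (openConn s y) ∧
        sahiE3 (prodBernoulli (Function.update w s(s, z) 1)) (openConn s b) (openConn s c) (openConn s y) ≤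
          3 * polar₁ (prodBernoulli (Function.update w s(s, z) 1)) (prodBernoulli (Function.update w s(s, z) 0))
            (openConn s b) (openConn s c) (openConn s y)) :
    ∀ (w : Sym2 (Fin n) → unitInterval) (s b c y : Fin n),
      0 ≤ sahiE3 (prodBernoulli w) (openConn s b) (openConn s c) (openConn s y) := by
  refine incStar_nonneg_of_rootUnmarkedBernsteinStrongIH ?_
  intro w s b c y z hzs hzb hzc hzy he IH
  have hnd : ¬ (s(s, z) : Sym2 (Fin n)).IsDiag := by rw [Sym2.mk_isDiag_iff]; exact hzs.symm
  -- the induction hypothesis at the two minors `w[e↦0]`, `w[e↦1]`: `B₀ ≥ 0`, `B₃ ≥ 0`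
  have h0 : 0 ≤ sahiE3 (prodBernoulli (Function.update w s(s, z) 0)) (openConn s b) (openConn s c) (openConn s y) :=
    IH _ (card_fracEdges_update_lt w he hnd 0 (Or.inl rfl)) s b c y
  have h1 : 0 ≤ sahiE3 (prodBernoulli (Function.update w s(s, z) 1)) (openConn s b) (openConn s c) (openConn s y) :=
    IH _ (card_fracEdges_update_lt w he hnd 1 (Or.inr rfl)) s b c y
  obtain ⟨o1, o2⟩ := hO w s b c y z hzs hzb hzc hzy he IH
  exact ⟨by linarith, by linarith⟩

/-- **Corollary (marking-free form).**  If ORDER-1 (`B₀ ≤ 3B₁` and `B₃ ≤ 3B₂`) holds for the increasing star along EVERY fractional non-loop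
root pair `s(s,v)`, for every weight and marking — granted the increasing star for all weights with fewer fractional non-loop pairs — then the
increasing star holds on every finite weighted graph on `Fin n`.  (At root–target pairs the hypothesis is in fact a theorem, see the header;
this form is the one matching the comb-polynomial conjecture COMB-M∓ restricted to star triples.) [this work] -/
theorem incStar_nonneg_of_orderOne
    (hO : ∀ (w : Sym2 (Fin n) → unitInterval) (s b c y v : Fin n), v ≠ s → s(s, v) ∈ fracEdges w →
      (∀ w' : Sym2 (Fin n) → unitInterval,
          ((fracEdges w').filter fun f => ¬ f.IsDiag).card < ((fracEdges w).filter fun f => ¬ f.IsDiag).card →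
          ∀ s' b' c' y' : Fin n, 0 ≤ sahiE3 (prodBernoulli w') (openConn s' b') (openConn s' c') (openConn s' y')) →
      sahiE3 (prodBernoulli (Function.update w s(s, v) 0)) (openConn s b) (openConn s c) (openConn s y) ≤
          3 * polar₁ (prodBernoulli (Function.update w s(s, v) 0)) (prodBernoulli (Function.update w s(s, v) 1))
            (openConn s b) (openConn s c) (openConn s y) ∧
        sahiE3 (prodBernoulli (Function.update w s(s, v) 1)) (openConn s b) (openConn s c) (openConn s y) ≤
          3 * polar₁ (prodBernoulli (Function.update w s(s, v) 1)) (prodBernoulli (Function.update w s(s, v) 0))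
            (openConn s b) (openConn s c) (openConn s y)) :
    ∀ (w : Sym2 (Fin n) → unitInterval) (s b c y : Fin n),
      0 ≤ sahiE3 (prodBernoulli w) (openConn s b) (openConn s c) (openConn s y) :=
  incStar_nonneg_of_rootUnmarkedOrderOne fun w s b c y z hzs _ _ _ he IH => hO w s b c y z hzs he IH

end IncStar

end Summit.CriticalPhenomena.PercolationContinuityZ3.Theorems
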